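import Summits.AtomisticToContinuum.Crystallization.Theorems.FrustratedLawDichotomyTwoShellRigidityLadder
import Summits.AtomisticToContinuum.Crystallization.Theorems.FrustratedLawDichotomyTwoShellRigidityCapTrilateration
import Summits.AtomisticToContinuum.Crystallization.Theorems.FrustratedLawDichotomyTwoShellRigidityCoarse

/-!
# FrustratedLawDichotomy · crux `AperiodicFrustratedLawGap` (stmt-AtomisticToContinuum-27623) — the ladder's cap hypotheses DISCHARGED
# (decomp-a2c, prover hand 1, gen 11; critic row 456 (B): «corollary cappedRigidity_of_coarse_c18′ without cap hypotheses»)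

lens-5's contraction ladder (`FrustratedLawDichotomyTwoShellRigidityLadder`, the L-format of record for the M column, critic row 452 (a))
reads the hand lane through `CoarseCappedRigidityAt K θ Pat` (R) and the cap a-priori `CapAprioriAt Kq K θ Pat`.  The cap a-priori with
`Kq = 54 + 2K` is PROVED for both kissing patterns in `FrustratedLawDichotomyTwoShellRigidityCapApriori` (p823350, from the landed
octahedral cell `OctaCellAt 18`, p822087).  This def-free file records the consequences BY NAME:

* `capAprioriAt_fcc`, `capAprioriAt_hcp : CapAprioriAt (54 + 2K) K θ Pat` for every `K` and every `0 < θ ≤ 1/100`;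
* `entryAt_fcc_of_coarse`, `entryAt_hcp_of_coarse` — **BASE RANGE ⟹ ENTRY with NO cap hypothesis**:
  `CoarseCappedRigidityAt K θ Pat ⟹ EntryAt θ (Kθ, (54+2K)θ, 2Kθ, (54+3K)θ) Pat`;
* `entryAt_fcc_4796`, `entryAt_hcp_4796` — the hand lane's ENTRY OF RECORD from the landed `R` with `K = 4796` (p822606): for every
  `0 < θ ≤ 1/100`, `EntryAt θ (4796θ, 9646θ, 9592θ, 14442θ)` at both patterns (an unconditional theorem; through the ladder it closes the M
  column once lens-5's entry map accepts the tuple, i.e. on the dial `θ ≲ 1/30000`, NODE-g31 §3 (c′));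
* `cappedRigidity_of_coarse_c18'` — lens-5's literal theorem with its two cap hypotheses DISCHARGED:
  `R_fcc(K ≤ 10) → R_hcp(K ≤ 6) → FccLadderCertC18 → HcpLadderCertC18 → CappedRigidity (1/100) (1/20)` (= M at the literals);
* `kr2Shape_of_coarse_c18`, `aperiodicFrustratedLawGap_of_coarse_c18` (crux of item 27623 BY NAME from `MuEquilibriumDoor ∧ ChargedEnergyGap ∧
  G ∧ P ∧ R_fcc(K ≤ 10) ∧ R_hcp(K ≤ 6) ∧` the two `c = 18` certificate chains) and `noFrustratedPeriodicMinimiser_of_coarse_c18` (item 26654);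
* from the TRILATERATION cap a-priori (`FrustratedLawDichotomyTwoShellRigidityCapTrilateration`, `Kq = 2(K+2+θ) + (K+2+θ)²θ`):
  `capAprioriAt_trilateration_fcc / _hcp`, and the SHARPENED hand targets `fccBridge_of_coarse_sixteen : 0 ≤ K ≤ 16 → R_fcc(K) → FccBridge`,
  `hcpBridge_of_coarse_eleven : 0 ≤ K ≤ 11 → R_hcp(K) → HcpBridge`, `cappedRigidity_of_coarse_sixteen_eleven : R_fcc(K ≤ 16) → R_hcp(K ≤ 11) →
  FccLadderCert → HcpLadderCert → CappedRigidity (1/100) (1/20)` and the crux / item 26654 by name (`…_of_coarse_sixteen_eleven`).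

So the M column at the literal now reads: hand target `R` with constant `16 / 11` (E-4 ladders) or `10 / 6` (c-18 ladders) — landed: `4796` —
`∧` two LP-certificate chains (census / certificate lane, modulo lens-5 g32's relaxation-validity lemma); no cap lemma outstanding.
`[folklore]` (chaining); def-free; no `sorry`.
-/

noncomputable section

namespace Summit.AtomisticToContinuum.Crystallization.Theorems.FrustratedLawDichotomyTwoShellRigidityLadderCap

open Literature.Geometry.DiscreteGeometry
open Summit.AtomisticToContinuum.Crystallization.Theses.PricedLinkCensus (ChargedEnergyGap)
open Summit.AtomisticToContinuum.Crystallization.Theorems.FrustratedLawDichotomyTwoShellRigidityCut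
open Summit.AtomisticToContinuum.Crystallization.Theorems.FrustratedLawDichotomyTwoShellRigidityCells
  (CoarseCappedRigidityAt CoarseCappedRigidity)
open Summit.AtomisticToContinuum.Crystallization.Theorems.FrustratedLawDichotomyTwoShellRigidityCoarse (coarseCappedRigidity_holds)
open Summit.AtomisticToContinuum.Crystallization.Theorems.FrustratedLawDichotomyTwoShellRigidityCapApriori (cap_apriori_fcc cap_apriori_hcp)
open Summit.AtomisticToContinuum.Crystallization.Theorems.FrustratedLawDichotomyTwoShellRigidityCapTrilateration
  (cap_apriori_trilateration_fcc cap_apriori_trilateration_hcp)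
open Summit.AtomisticToContinuum.Crystallization.Theorems.FrustratedLawDichotomyTwoShellRigidityLadder

/-! ### The cap a-priori BY NAME -/

/-- **`CapAprioriAt (54 + 2K) K θ fccKissingPattern`** for every `K` and `0 < θ ≤ 1/100` (p823350's `cap_apriori_fcc` is its body). [folklore] -/
theorem capAprioriAt_fcc {K θ : ℝ} (hθ0 : 0 < θ) (hθ1 : θ ≤ 1 / 100) : CapAprioriAt (54 + 2 * K) K θ fccKissingPattern :=
  fun N y i τ hy hsep hL hC A hA u v m huv hmi hb => cap_apriori_fcc hθ0 hθ1 N y i τ hy hsep hL hC A hA u v m huv hmi hb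

/-- **`CapAprioriAt (54 + 2K) K θ hcpKissingPattern`** for every `K` and `0 < θ ≤ 1/100`. [folklore] -/
theorem capAprioriAt_hcp {K θ : ℝ} (hθ0 : 0 < θ) (hθ1 : θ ≤ 1 / 100) : CapAprioriAt (54 + 2 * K) K θ hcpKissingPattern :=
  fun N y i τ hy hsep hL hC A hA u v m huv hmi hb => cap_apriori_hcp hθ0 hθ1 N y i τ hy hsep hL hC A hA u v m huv hmi hb

/-! ### Base range ⟹ entry, with no cap hypothesis -/

/-- **fcc: `R ⟹ Entry`** — `CoarseCappedRigidityAt K θ fcc ⟹ EntryAt θ (Kθ, (54+2K)θ, 2Kθ, (54+3K)θ) fcc` (`0 < θ ≤ 1/100`). [folklore] -/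
theorem entryAt_fcc_of_coarse {K θ : ℝ} (hθ0 : 0 < θ) (hθ1 : θ ≤ 1 / 100) (hR : CoarseCappedRigidityAt K θ fccKissingPattern) :
    EntryAt θ (K * θ, (54 + 2 * K) * θ, 2 * K * θ, (54 + 3 * K) * θ) fccKissingPattern := by
  have h := entryAt_of_coarse_of_capApriori hR (capAprioriAt_fcc (K := K) hθ0 hθ1)
  have e : (54 + 2 * K + K) * θ = (54 + 3 * K) * θ := by ring
  rw [e] at h
  exact h

/-- **hcp: `R ⟹ Entry`** — `CoarseCappedRigidityAt K θ hcp ⟹ EntryAt θ (Kθ, (54+2K)θ, 2Kθ, (54+3K)θ) hcp` (`0 < θ ≤ 1/100`). [folklore] -/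
theorem entryAt_hcp_of_coarse {K θ : ℝ} (hθ0 : 0 < θ) (hθ1 : θ ≤ 1 / 100) (hR : CoarseCappedRigidityAt K θ hcpKissingPattern) :
    EntryAt θ (K * θ, (54 + 2 * K) * θ, 2 * K * θ, (54 + 3 * K) * θ) hcpKissingPattern := by
  have h := entryAt_of_coarse_of_capApriori hR (capAprioriAt_hcp (K := K) hθ0 hθ1)
  have e : (54 + 2 * K + K) * θ = (54 + 3 * K) * θ := by ring
  rw [e] at h
  exact h

/-- **The hand lane's ENTRY OF RECORD, fcc**: from the landed `R` with `K = 4796` (p822606), for every `0 < θ ≤ 1/100`,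
`EntryAt θ (4796θ, 9646θ, 9592θ, 14442θ) fccKissingPattern` — unconditional. [folklore] -/
theorem entryAt_fcc_4796 {θ : ℝ} (hθ0 : 0 < θ) (hθ1 : θ ≤ 1 / 100) :
    EntryAt θ (4796 * θ, 9646 * θ, 9592 * θ, 14442 * θ) fccKissingPattern := by
  have h := entryAt_fcc_of_coarse hθ0 hθ1 (coarseCappedRigidity_holds hθ0 hθ1).1
  norm_num at h
  exact h

/-- **The hand lane's ENTRY OF RECORD, hcp**: `EntryAt θ (4796θ, 9646θ, 9592θ, 14442θ) hcpKissingPattern` for every `0 < θ ≤ 1/100`. [folklore] -/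
theorem entryAt_hcp_4796 {θ : ℝ} (hθ0 : 0 < θ) (hθ1 : θ ≤ 1 / 100) :
    EntryAt θ (4796 * θ, 9646 * θ, 9592 * θ, 14442 * θ) hcpKissingPattern := by
  have h := entryAt_hcp_of_coarse hθ0 hθ1 (coarseCappedRigidity_holds hθ0 hθ1).2
  norm_num at h
  exact h

/-! ### lens-5's literal theorem with the cap hypotheses discharged -/

/-- **M at the literals `(1/100, 1/20)` from the hand lane's R at `K ≤ 10` (fcc) / `K ≤ 6` (hcp) and the two `c = 18` certificate chains —
NO cap hypothesis** (lens-5's `cappedRigidity_of_coarse_c18` with `hQf`, `hQh` supplied by `capAprioriAt_fcc / _hcp`). [folklore] -/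
theorem cappedRigidity_of_coarse_c18' {Kf Kh : ℝ} (hKf : Kf ≤ 10) (hKh : Kh ≤ 6)
    (hRf : CoarseCappedRigidityAt Kf (1 / 100) fccKissingPattern) (hRh : CoarseCappedRigidityAt Kh (1 / 100) hcpKissingPattern)
    (hCf : FccLadderCertC18) (hCh : HcpLadderCertC18) : CappedRigidity (1 / 100) (1 / 20) :=
  cappedRigidity_of_coarse_c18 hKf hKh hRf (capAprioriAt_fcc (by norm_num) le_rfl) hRh (capAprioriAt_hcp (by norm_num) le_rfl) hCf hCh

/-- **`KR2Shape` from G, P, the hand lane's R (`10 / 6`) and the two `c = 18` chains.** [folklore] -/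
theorem kr2Shape_of_coarse_c18 {Kf Kh : ℝ} (hKf : Kf ≤ 10) (hKh : Kh ≤ 6)
    (hG : LinkClassification (1 / 100)) (hP : CapForcing (1 / 100))
    (hRf : CoarseCappedRigidityAt Kf (1 / 100) fccKissingPattern) (hRh : CoarseCappedRigidityAt Kh (1 / 100) hcpKissingPattern)
    (hCf : FccLadderCertC18) (hCh : HcpLadderCertC18) : KR2Shape :=
  kr2Shape_of_cut hG hP (cappedRigidity_of_coarse_c18' hKf hKh hRf hRh hCf hCh)

/-- **Through the door, BY NAME: `AperiodicFrustratedLawGap` (crux of item 27623) from `MuEquilibriumDoor ∧ ChargedEnergyGap ∧ G ∧ P ∧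
R_fcc(K ≤ 10) ∧ R_hcp(K ≤ 6) ∧ FccLadderCertC18 ∧ HcpLadderCertC18`** — the ladder reading of the M column with no cap lemma outstanding.
[folklore] -/
theorem aperiodicFrustratedLawGap_of_coarse_c18 {Kf Kh : ℝ} (hKf : Kf ≤ 10) (hKh : Kh ≤ 6)
    (hDoor : Summit.AtomisticToContinuum.Crystallization.Theses.GrainCoreNetworkSplit.MuEquilibriumDoor) (hgap : ChargedEnergyGap)
    (hG : LinkClassification (1 / 100)) (hP : CapForcing (1 / 100))
    (hRf : CoarseCappedRigidityAt Kf (1 / 100) fccKissingPattern) (hRh : CoarseCappedRigidityAt Kh (1 / 100) hcpKissingPattern)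
    (hCf : FccLadderCertC18) (hCh : HcpLadderCertC18) :
    Summit.AtomisticToContinuum.Crystallization.Theses.FrustratedLawDichotomy.AperiodicFrustratedLawGap :=
  aperiodicFrustratedLawGap_of_cut hDoor hgap hG hP (cappedRigidity_of_coarse_c18' hKf hKh hRf hRh hCf hCh)

/-- **Door-free, BY NAME: `NoFrustratedPeriodicMinimiser` (item 26654) from `ChargedEnergyGap ∧ G ∧ P ∧ R_fcc(K ≤ 10) ∧ R_hcp(K ≤ 6) ∧` the
two `c = 18` chains.** [folklore] -/
theorem noFrustratedPeriodicMinimiser_of_coarse_c18 {Kf Kh : ℝ} (hKf : Kf ≤ 10) (hKh : Kh ≤ 6) (hgap : ChargedEnergyGap)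
    (hG : LinkClassification (1 / 100)) (hP : CapForcing (1 / 100))
    (hRf : CoarseCappedRigidityAt Kf (1 / 100) fccKissingPattern) (hRh : CoarseCappedRigidityAt Kh (1 / 100) hcpKissingPattern)
    (hCf : FccLadderCertC18) (hCh : HcpLadderCertC18) :
    Summit.AtomisticToContinuum.Crystallization.Theses.PeriodicChargeSplit.NoFrustratedPeriodicMinimiser :=
  noFrustratedPeriodicMinimiser_of_cut hgap hG hP (cappedRigidity_of_coarse_c18' hKf hKh hRf hRh hCf hCh)

/-! ### The trilateration cap a-priori BY NAME and the sharpened hand targets `16 / 11` -/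

/-- **`CapAprioriAt (2(K+2+θ) + (K+2+θ)²θ) K θ fccKissingPattern`** (`0 < θ ≤ 1/100`, `0 ≤ K`, `(K+2+θ)θ ≤ 1/5`; the body is
`cap_apriori_trilateration_fcc` of `FrustratedLawDichotomyTwoShellRigidityCapTrilateration`). [folklore] -/
theorem capAprioriAt_trilateration_fcc {K θ : ℝ} (hθ0 : 0 < θ) (hθ1 : θ ≤ 1 / 100) (hK : 0 ≤ K) (hKθ : (K + 2 + θ) * θ ≤ 1 / 5) :
    CapAprioriAt (2 * (K + 2 + θ) + (K + 2 + θ) ^ 2 * θ) K θ fccKissingPattern :=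
  fun N y i τ hy hsep hL hC A hA u v m huv hmi hb =>
    cap_apriori_trilateration_fcc hθ0 hθ1 hK hKθ N y i τ hy hsep hL hC A hA u v m huv hmi hb

/-- **`CapAprioriAt (2(K+2+θ) + (K+2+θ)²θ) K θ hcpKissingPattern`** (`0 < θ ≤ 1/100`, `0 ≤ K`, `(K+2+θ)θ ≤ 1/5`). [folklore] -/
theorem capAprioriAt_trilateration_hcp {K θ : ℝ} (hθ0 : 0 < θ) (hθ1 : θ ≤ 1 / 100) (hK : 0 ≤ K) (hKθ : (K + 2 + θ) * θ ≤ 1 / 5) :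
    CapAprioriAt (2 * (K + 2 + θ) + (K + 2 + θ) ^ 2 * θ) K θ hcpKissingPattern :=
  fun N y i τ hy hsep hL hC A hA u v m huv hmi hb =>
    cap_apriori_trilateration_hcp hθ0 hθ1 hK hKθ N y i τ hy hsep hL hC A hA u v m huv hmi hb

/-- **fcc bridge from the hand lane at `K ≤ 16`**: `CoarseCappedRigidityAt K (1/100) fcc` with `0 ≤ K ≤ 16` gives lens-5's `FccBridge`
(`= EntryAt (1/100) (0.18, 0.40, 0.36, 0.58)`): the trilateration cap a-priori has `Kq(16) = 39.2636 ≤ 40`. [folklore] -/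
theorem fccBridge_of_coarse_sixteen {K : ℝ} (hK0 : 0 ≤ K) (hK : K ≤ 16) (hR : CoarseCappedRigidityAt K (1 / 100) fccKissingPattern) :
    FccBridge := by
  have hKθ : (K + 2 + 1 / 100) * (1 / 100) ≤ 1 / 5 := by nlinarith
  have hKq : 2 * (K + 2 + 1 / 100) + (K + 2 + 1 / 100) ^ 2 * (1 / 100) ≤ 40 := by
    nlinarith [mul_nonneg hK0 (by linarith : (0 : ℝ) ≤ 16 - K)]
  exact fccBridge_of_coarse (by linarith) hKq hR (capAprioriAt_trilateration_fcc (by norm_num) le_rfl hK0 hKθ)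

/-- **hcp bridge from the hand lane at `K ≤ 11`**: `CoarseCappedRigidityAt K (1/100) hcp` with `0 ≤ K ≤ 11` gives lens-5's `HcpBridge`
(`= EntryAt (1/100) (0.12, 0.28, 0.24, 0.40)`): `Kq(11) = 27.7126 ≤ 28`. [folklore] -/
theorem hcpBridge_of_coarse_eleven {K : ℝ} (hK0 : 0 ≤ K) (hK : K ≤ 11) (hR : CoarseCappedRigidityAt K (1 / 100) hcpKissingPattern) :
    HcpBridge := by
  have hKθ : (K + 2 + 1 / 100) * (1 / 100) ≤ 1 / 5 := by nlinarith
  have hKq : 2 * (K + 2 + 1 / 100) + (K + 2 + 1 / 100) ^ 2 * (1 / 100) ≤ 28 := by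
    nlinarith [mul_nonneg hK0 (by linarith : (0 : ℝ) ≤ 11 - K)]
  exact hcpBridge_of_coarse (by linarith) hKq hR (capAprioriAt_trilateration_hcp (by norm_num) le_rfl hK0 hKθ)

/-- **M at the literals from the hand lane at `16 / 11` and lens-5's two E-4 certificate chains** (`FccLadderCert`, `HcpLadderCert`):
`R_fcc(0 ≤ K ≤ 16) → R_hcp(0 ≤ K ≤ 11) → FccLadderCert → HcpLadderCert → CappedRigidity (1/100) (1/20)` — the SHARPENED hand target of the M column
(critic row 452 (b) reading B: «16–18 / 12–14 with a cap lemma»). [folklore] -/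
theorem cappedRigidity_of_coarse_sixteen_eleven {Kf Kh : ℝ} (hKf0 : 0 ≤ Kf) (hKf : Kf ≤ 16) (hKh0 : 0 ≤ Kh) (hKh : Kh ≤ 11)
    (hRf : CoarseCappedRigidityAt Kf (1 / 100) fccKissingPattern) (hRh : CoarseCappedRigidityAt Kh (1 / 100) hcpKissingPattern)
    (hCf : FccLadderCert) (hCh : HcpLadderCert) : CappedRigidity (1 / 100) (1 / 20) :=
  cappedRigidity_of_bridges_of_certs (fccBridge_of_coarse_sixteen hKf0 hKf hRf) hCf (hcpBridge_of_coarse_eleven hKh0 hKh hRh) hCh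

/-- **`KR2Shape` from G, P, the hand lane at `16 / 11` and the two E-4 chains.** [folklore] -/
theorem kr2Shape_of_coarse_sixteen_eleven {Kf Kh : ℝ} (hKf0 : 0 ≤ Kf) (hKf : Kf ≤ 16) (hKh0 : 0 ≤ Kh) (hKh : Kh ≤ 11)
    (hG : LinkClassification (1 / 100)) (hP : CapForcing (1 / 100))
    (hRf : CoarseCappedRigidityAt Kf (1 / 100) fccKissingPattern) (hRh : CoarseCappedRigidityAt Kh (1 / 100) hcpKissingPattern)
    (hCf : FccLadderCert) (hCh : HcpLadderCert) : KR2Shape :=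
  kr2Shape_of_cut hG hP (cappedRigidity_of_coarse_sixteen_eleven hKf0 hKf hKh0 hKh hRf hRh hCf hCh)

/-- **Through the door, BY NAME: `AperiodicFrustratedLawGap` (crux of item 27623) from `MuEquilibriumDoor ∧ ChargedEnergyGap ∧ G ∧ P ∧
R_fcc(K ≤ 16) ∧ R_hcp(K ≤ 11) ∧ FccLadderCert ∧ HcpLadderCert`.** [folklore] -/
theorem aperiodicFrustratedLawGap_of_coarse_sixteen_eleven {Kf Kh : ℝ} (hKf0 : 0 ≤ Kf) (hKf : Kf ≤ 16) (hKh0 : 0 ≤ Kh) (hKh : Kh ≤ 11)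
    (hDoor : Summit.AtomisticToContinuum.Crystallization.Theses.GrainCoreNetworkSplit.MuEquilibriumDoor) (hgap : ChargedEnergyGap)
    (hG : LinkClassification (1 / 100)) (hP : CapForcing (1 / 100))
    (hRf : CoarseCappedRigidityAt Kf (1 / 100) fccKissingPattern) (hRh : CoarseCappedRigidityAt Kh (1 / 100) hcpKissingPattern)
    (hCf : FccLadderCert) (hCh : HcpLadderCert) :
    Summit.AtomisticToContinuum.Crystallization.Theses.FrustratedLawDichotomy.AperiodicFrustratedLawGap :=
  aperiodicFrustratedLawGap_of_cut hDoor hgap hG hP (cappedRigidity_of_coarse_sixteen_eleven hKf0 hKf hKh0 hKh hRf hRh hCf hCh)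

/-- **Door-free, BY NAME: `NoFrustratedPeriodicMinimiser` (item 26654) from `ChargedEnergyGap ∧ G ∧ P ∧ R_fcc(K ≤ 16) ∧ R_hcp(K ≤ 11) ∧` the two
E-4 chains.** [folklore] -/
theorem noFrustratedPeriodicMinimiser_of_coarse_sixteen_eleven {Kf Kh : ℝ} (hKf0 : 0 ≤ Kf) (hKf : Kf ≤ 16) (hKh0 : 0 ≤ Kh) (hKh : Kh ≤ 11)
    (hgap : ChargedEnergyGap) (hG : LinkClassification (1 / 100)) (hP : CapForcing (1 / 100))
    (hRf : CoarseCappedRigidityAt Kf (1 / 100) fccKissingPattern) (hRh : CoarseCappedRigidityAt Kh (1 / 100) hcpKissingPattern)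
    (hCf : FccLadderCert) (hCh : HcpLadderCert) :
    Summit.AtomisticToContinuum.Crystallization.Theses.PeriodicChargeSplit.NoFrustratedPeriodicMinimiser :=
  noFrustratedPeriodicMinimiser_of_cut hgap hG hP (cappedRigidity_of_coarse_sixteen_eleven hKf0 hKf hKh0 hKh hRf hRh hCf hCh)

end Summit.AtomisticToContinuum.Crystallization.Theorems.FrustratedLawDichotomyTwoShellRigidityLadderCap

end
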